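import Summits.QuantumFields.BalabanUV.Beta.GAN24.DerivativeRateTransferJensenMassFreeConventionLocal
import Summits.QuantumFields.BalabanUV.Beta.GAN24.DerivativeRateTransferJensenMassFreeLocalEnd
import Summits.QuantumFields.BalabanUV.Beta.GAN24.DerivativeRateTransferJensenMassFreeTransfer

/-!
# `BalabanUV.Beta.GAN24.DerivativeRateTransferJensenMassFreeExpMeanEnd` — binder row G-an2-4 ∕ (CONV-C), route R6 «VALUES, NOT DERIVATIVES», PART 72:
# THE (1.28) PAIR's (STAB-ε,δ) FROM THE FINE FIELD AND THE LOCAL LOOP LETTER — PART 56's convention transfer with every letter discharged: from block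
# weights, orthogonal block ∕ fine transporters, the averaging identity, a fine form dominating the fine bond energy, straight chains, the Poincaré datum and
# the SUPPORT-LOCAL loop letter `D` (operator form; `D < 1`, `√(dim o)·D ≤ 1∕8`), THERE ARE polar links `R′` (PART 58) and exp-mean-log links
# `R″(e′) = exp(Σ_{q≠0} q(src′e′,x)·log(τ(e′,x)τ(e′,x₀)ᵀ))·τ(e′,x₀)` (PART 71) such that
#   (i) the polar pair: `⟨Qu, H_cQu⟩ ≤ (1 + ε(2D, ϖ, ϖ′; t, r))·⟨u, H_fu⟩` for every `H_c ≤ w_cΣ|R′v − v|²` (δ = 0, PART 62), and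
#   (ii) the (1.28) pair: `⟨Qu, H″_cQu⟩ ≤ (1+s)(1 + ε)·⟨u, H_fu⟩ + (1+s⁻¹)·(20D_F³ + 784D_F⁴)²·w_c·d′·⟨Qu, Qu⟩` for every `H″_c ≤ w_cΣ|R″v − v|²`,
# `D_F = √(dim o)·D` — the additive slack is SIXTH ORDER in the loop letter (unit b2b-balaban-gan24-p3, gen 45; v1)

NOT IN PRINT; OUR PROOF (for the ROUTE; PART 56 `covJensen_transfer` + PART 62 `sum_coarseDiff_sq_le_polar_local` ∕ `rootDefect_le_of_polar_loops_local` ∕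
`covJensen_polar_massFree_of_loops_local` + PART 58 `exists_polarLink` + PART 71 `transferLetter_of_transports_local` BY NAME).  HONEST FRAMING (cell
contract, verbatim): «discharging `BetaPertH` makes Bałaban's UV stability UNCONDITIONAL — a real constructive-QFT result; it is NOT the continuum limit and
NOT the Clay problem.»  HONEST DEPENDENCY (verbatim): «continuum YM on T⁴ ⇐ BetaPertH ∧ nine spine estimates (0/9 proved); BetaPertH ⇐ (D1) ∧ (D4) ∧
CAP+tail; G-an2-4 gates asym, D1 and NE2/3/4.»

WHAT THIS FILE PROVES (0 sorry, 0 `def`, nothing cited): **`covJensen_transfer_of_polar_local`** (PART 56's `covJensen_transfer_of_polar` with the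
support-local loop letter and the polar letters instead of the global defect letter `hN`), **`exists_polar_expMean_covJensen_local`** (the capstone: both
pairs' ENDs with every convention ∕ defect ∕ logarithm letter discharged; what is left is the loop letter `D`, the in-degree `d′`, the weights and the
Poincaré datum).
WHAT IT DOES NOT DO: the concrete block lattice (PART 63 ∕ 64 pattern applies verbatim — ON REQUEST), the tower, (CONS), (CONV-C), anything of Bałaban's.
SUPPLIER work on route R6 (rank 2, REDUCTION, no seat); no consumer of record; NEVER «G-an2-4 closed»; NOT (CONV-C), NOT D1, NOT `BetaPertH`, NOT continuum,
NOT Clay.  Records: `HOME/b2b-balaban-gan24-p3/WOODBURY-FIBRE.md` v14.5. -/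

noncomputable section

open scoped Matrix Matrix.Norms.Frobenius
open NormedSpace Matrix Finset

namespace Summit.QuantumFields.BalabanUV.Beta.GAN24.DerivativeRateTransferJensenMassFreeExpMeanEnd

open Summit.QuantumFields.BalabanUV.Beta.GAN24.DerivativeRateTransferJensenChain
open Summit.QuantumFields.BalabanUV.Beta.GAN24.DerivativeRateTransferJensenMassFreeTransfer
open Summit.QuantumFields.BalabanUV.Beta.GAN24.DerivativeRateTransferJensenMassFreePolarFactor
open Summit.QuantumFields.BalabanUV.Beta.GAN24.DerivativeRateTransferJensenMassFreeLocalEnd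
open Summit.QuantumFields.BalabanUV.Beta.GAN24.DerivativeRateTransferJensenMassFreeConventionLocal

section End

variable {o μ ν β β' : Type*} [Fintype o] [DecidableEq o] [Fintype μ] [DecidableEq μ] [Fintype ν] [Fintype β] [DecidableEq β] [Fintype β']
variable {q : μ → ν → ℝ} {W : μ → ν → Matrix o o ℝ} {Q : Matrix (μ × o) (ν × o) ℝ}
variable {src tgt : β → ν} {R : β → Matrix o o ℝ} {src' tgt' : β' → μ} {R' R'' : β' → Matrix o o ℝ}
variable {Hf : Matrix (ν × o) (ν × o) ℝ} {Hc : Matrix (μ × o) (μ × o) ℝ} {wf wc : ℝ}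
variable {σ : β' → ν ≃ ν} {ℓ : ℕ} {xs : β' → ν → ℕ → ν} {γ : β' → ν → ℕ → β} {T : β' → ν → ℕ → Matrix o o ℝ} {m : ℝ}
variable {Φ : (ν × o → ℝ) → μ → ℝ} {ϖ ϖ' D τ d' : ℝ}

/-- **`covJensen_transfer_of_polar_local` — PART 56's CONVENTION TRANSFER WITH THE SUPPORT-LOCAL LOOP LETTER** [our proof]: as PART 56
`covJensen_transfer_of_polar`, with the global defect letter `hN` replaced by the polar letters `hsym` ∕ `hPpsd` and the loop letter `hloop` on the support
(`0 ≤ D < 1`; `κ = 2D`).  For a second coarse connection `R″` within `τ` of `R′` and a coarse form `H″_c ≤ w_cΣ|R″v − v|²`, for all `s, t, r > 0`: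
`⟨Qu, H″_cQu⟩ ≤ (1+s)(1 + t + (1+t⁻¹)(1+r)ϖ(2D)² + (1+t⁻¹)(1+r⁻¹)·3(2D)²(1+ϖ+ϖ′)∕(4−(2D)²))·⟨u, H_fu⟩ + (1+s⁻¹)·τ²·w_c·d′·⟨Qu, Qu⟩`. -/
theorem covJensen_transfer_of_polar_local
    (hq : ∀ y x, 0 ≤ q y x) (hq1 : ∀ y, ∑ x, q y x = 1) (hW : ∀ y x, (W y x)ᵀ * W y x = 1) (hR : ∀ e, (R e)ᵀ * R e = 1)
    (hR' : ∀ e', (R' e')ᵀ * R' e' = 1)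
    (hQ : ∀ (u : ν × o → ℝ) (y : μ), (fun a => (Q *ᵥ u) (y, a)) = ∑ x, q y x • (W y x *ᵥ fun b => u (x, b)))
    (hwc : 0 ≤ wc)
    (hHc : ∀ v : μ × o → ℝ, v ⬝ᵥ (Hc *ᵥ v) ≤
      wc * ∑ e', ((R'' e' *ᵥ fun a => v (tgt' e', a)) - fun a => v (src' e', a)) ⬝ᵥ
        ((R'' e' *ᵥ fun a => v (tgt' e', a)) - fun a => v (src' e', a)))
    (hτ : ∀ e' (w : o → ℝ), ((R'' e' - R' e') *ᵥ w) ⬝ᵥ ((R'' e' - R' e') *ᵥ w) ≤ τ ^ 2 * (w ⬝ᵥ w))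
    (hHf : ∀ u : ν × o → ℝ, wf * ∑ e, ((R e *ᵥ fun b => u (tgt e, b)) - fun b => u (src e, b)) ⬝ᵥ
        ((R e *ᵥ fun b => u (tgt e, b)) - fun b => u (src e, b)) ≤ u ⬝ᵥ (Hf *ᵥ u))
    (hσq : ∀ e' x, q (tgt' e') (σ e' x) = q (src' e') x)
    (hx0 : ∀ e' x, xs e' x 0 = x) (hxℓ : ∀ e' x, xs e' x ℓ = σ e' x)
    (hsrc : ∀ e' x i, i < ℓ → src (γ e' x i) = xs e' x i) (htgt : ∀ e' x i, i < ℓ → tgt (γ e' x i) = xs e' x (i + 1))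
    (hT0 : ∀ e' x, T e' x 0 = 1) (hT : ∀ e' x i, i < ℓ → T e' x (i + 1) = T e' x i * R (γ e' x i))
    (hmult : ∀ e, ∑ e', ∑ x, ∑ i ∈ range ℓ, (if γ e' x i = e then q (src' e') x else 0) ≤ m)
    (hw : wc * ℓ * m ≤ wf)
    (hsym : ∀ e', (∑ x, q (src' e') x • (1 - W (src' e') x * T e' x ℓ * (W (tgt' e') (σ e' x))ᵀ * (R' e')ᵀ))ᵀ =
      ∑ x, q (src' e') x • (1 - W (src' e') x * T e' x ℓ * (W (tgt' e') (σ e' x))ᵀ * (R' e')ᵀ))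
    (hPpsd : ∀ e' (w : o → ℝ), 0 ≤ w ⬝ᵥ ((∑ x, q (src' e') x • (W (src' e') x * T e' x ℓ * (W (tgt' e') (σ e' x))ᵀ * (R' e')ᵀ)) *ᵥ w))
    (hloop : ∀ e' x x', q (src' e') x ≠ 0 → q (src' e') x' ≠ 0 → ∀ w : o → ℝ,
      (((W (src' e') x * T e' x ℓ * (W (tgt' e') (σ e' x))ᵀ)ᵀ * (W (src' e') x' * T e' x' ℓ * (W (tgt' e') (σ e' x'))ᵀ) - 1) *ᵥ w) ⬝ᵥ
          (((W (src' e') x * T e' x ℓ * (W (tgt' e') (σ e' x))ᵀ)ᵀ * (W (src' e') x' * T e' x' ℓ * (W (tgt' e') (σ e' x'))ᵀ) - 1) *ᵥ w) ≤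
        D ^ 2 * (w ⬝ᵥ w))
    (hD0 : 0 ≤ D) (hD1 : D < 1)
    (hdeg : ∀ y, ((Finset.univ.filter fun e' => tgt' e' = y).card : ℝ) ≤ d')
    (u : ν × o → ℝ)
    (hP : ∀ y, ∑ x, q y x * (((W y x *ᵥ fun b => u (x, b)) - fun a => (Q *ᵥ u) (y, a)) ⬝ᵥ
        ((W y x *ᵥ fun b => u (x, b)) - fun a => (Q *ᵥ u) (y, a))) ≤ Φ u y)
    (hΦ : wc * ∑ e', Φ u (tgt' e') ≤ ϖ * (u ⬝ᵥ (Hf *ᵥ u))) (hΦ' : wc * ∑ e', Φ u (src' e') ≤ ϖ' * (u ⬝ᵥ (Hf *ᵥ u)))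
    {s t r : ℝ} (hs : 0 < s) (ht : 0 < t) (hr : 0 < r) :
    (Q *ᵥ u) ⬝ᵥ (Hc *ᵥ (Q *ᵥ u)) ≤
      (1 + s) * ((1 + t + (1 + t⁻¹) * (1 + r) * ϖ * (2 * D) ^ 2 +
          (1 + t⁻¹) * (1 + r⁻¹) * (3 * (2 * D) ^ 2 / (4 - (2 * D) ^ 2)) * (1 + ϖ + ϖ')) * (u ⬝ᵥ (Hf *ᵥ u))) +
        (1 + s⁻¹) * τ ^ 2 * wc * d' * ((Q *ᵥ u) ⬝ᵥ (Q *ᵥ u)) := by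
  have hN : ∀ e' x, q (src' e') x ≠ 0 → ∀ w : o → ℝ,
      ((1 - W (src' e') x * T e' x ℓ * (W (tgt' e') (σ e' x))ᵀ * (R' e')ᵀ) *ᵥ w) ⬝ᵥ
        ((1 - W (src' e') x * T e' x ℓ * (W (tgt' e') (σ e' x))ᵀ * (R' e')ᵀ) *ᵥ w) ≤ (2 * D) ^ 2 * (w ⬝ᵥ w) := fun e' x hx w =>
    rootDefect_le_of_polar_loops_local (N := fun e' x => 1 - W (src' e') x * T e' x ℓ * (W (tgt' e') (σ e' x))ᵀ * (R' e')ᵀ)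
      hq hq1 hW hR hR' hT0 hT (fun _ _ => rfl) hsym hPpsd hloop e' x hx w
  have hκ : (2 * D) ^ 2 < 4 := by nlinarith
  exact covJensen_transfer hwc hHc hτ hdeg u
    (sum_coarseDiff_sq_le_polar_local (N := fun e' x => 1 - W (src' e') x * T e' x ℓ * (W (tgt' e') (σ e' x))ᵀ * (R' e')ᵀ)
      hq hq1 hW hR hR' hQ hwc hHf hσq hx0 hxℓ hsrc htgt hT0 hT hmult hw (fun _ _ => rfl) hN hsym hκ u hP hΦ hΦ' ht hr) hs

/-- **`exists_polar_expMean_covJensen_local` — BOTH PAIRS' ENDs FROM THE FINE FIELD AND THE LOCAL LOOP LETTER** [our proof; the capstone of PARTs 66–72].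
Data about the FINE field only (PART 62's `exists_polarLink_covJensen_massFree_local`): block weights, orthogonal `W` and `R`, the averaging identity,
`H_f ≥ w_fΣ_e|D_eu|²`, pairings, straight chains with multiplicity `≤ m`, the support-local loop letter with `0 ≤ D < 1` and `√(dim o)·D ≤ 1∕8`, in-degree
`≤ d′`.  For ANY prescribed roots `x₀(e′)` of nonzero weight THEN there are (a) polar links `R′` (orthogonal), (b) skew logarithms `A(e′,x)` on the supports
(`exp(A(e′,x))·τ(e′,x₀e′) = τ(e′,x)`, `‖A(e′,x)‖ ≤ 2√(dim o)·D`, `τ = W T W′ᵀ`), such that for every `w_c ≥ 0` with `w_c·ℓ·m ≤ w_f`, every `u` with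
Poincaré data and all `s, t, r > 0`: (i) for every `H_c ≤ w_cΣ|R′v − v|²`, PART 62's `δ = 0` END; (ii) for every `H″_c ≤ w_cΣ|R″v − v|²` with
`R″(e′) = exp(Σ_{q≠0} q•A(e′,·))·τ(e′,x₀e′)` (Bałaban–Jaffe (1.28)):
`⟨Qu, H″_cQu⟩ ≤ (1+s)(1 + ε)·⟨u, H_fu⟩ + (1+s⁻¹)·(20D_F³ + 784D_F⁴)²·w_c·d′·⟨Qu, Qu⟩`, `D_F = √(dim o)·D`. -/
theorem exists_polar_expMean_covJensen_local
    (hq : ∀ y x, 0 ≤ q y x) (hq1 : ∀ y, ∑ x, q y x = 1) (hW : ∀ y x, (W y x)ᵀ * W y x = 1) (hR : ∀ e, (R e)ᵀ * R e = 1)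
    (hQ : ∀ (u : ν × o → ℝ) (y : μ), (fun a => (Q *ᵥ u) (y, a)) = ∑ x, q y x • (W y x *ᵥ fun b => u (x, b)))
    (hHf : ∀ u : ν × o → ℝ, wf * ∑ e, ((R e *ᵥ fun b => u (tgt e, b)) - fun b => u (src e, b)) ⬝ᵥ
        ((R e *ᵥ fun b => u (tgt e, b)) - fun b => u (src e, b)) ≤ u ⬝ᵥ (Hf *ᵥ u))
    (hσq : ∀ e' x, q (tgt' e') (σ e' x) = q (src' e') x)
    (hx0 : ∀ e' x, xs e' x 0 = x) (hxℓ : ∀ e' x, xs e' x ℓ = σ e' x)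
    (hsrc : ∀ e' x i, i < ℓ → src (γ e' x i) = xs e' x i) (htgt : ∀ e' x i, i < ℓ → tgt (γ e' x i) = xs e' x (i + 1))
    (hT0 : ∀ e' x, T e' x 0 = 1) (hT : ∀ e' x i, i < ℓ → T e' x (i + 1) = T e' x i * R (γ e' x i))
    (hmult : ∀ e, ∑ e', ∑ x, ∑ i ∈ range ℓ, (if γ e' x i = e then q (src' e') x else 0) ≤ m)
    (hloop : ∀ e' x x', q (src' e') x ≠ 0 → q (src' e') x' ≠ 0 → ∀ w : o → ℝ,
      (((W (src' e') x * T e' x ℓ * (W (tgt' e') (σ e' x))ᵀ)ᵀ * (W (src' e') x' * T e' x' ℓ * (W (tgt' e') (σ e' x'))ᵀ) - 1) *ᵥ w) ⬝ᵥ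
          (((W (src' e') x * T e' x ℓ * (W (tgt' e') (σ e' x))ᵀ)ᵀ * (W (src' e') x' * T e' x' ℓ * (W (tgt' e') (σ e' x'))ᵀ) - 1) *ᵥ w) ≤
        D ^ 2 * (w ⬝ᵥ w))
    (hD0 : 0 ≤ D) (hD1 : D < 1) (hD8 : Real.sqrt (Fintype.card o) * D ≤ 1 / 8)
    (hdeg : ∀ y, ((Finset.univ.filter fun e' => tgt' e' = y).card : ℝ) ≤ d') {x₀ : β' → ν} (hx₀ : ∀ e', q (src' e') (x₀ e') ≠ 0) :
    ∃ (R' : β' → Matrix o o ℝ) (A : ∀ e' : β', {x : ν // q (src' e') x ≠ 0} → Matrix o o ℝ),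
      (∀ e', (R' e')ᵀ * R' e' = 1) ∧ (∀ e' x, (A e' x)ᵀ = -A e' x) ∧
      (∀ e' x, exp (A e' x) * (W (src' e') (x₀ e') * T e' (x₀ e') ℓ * (W (tgt' e') (σ e' (x₀ e')))ᵀ) =
        W (src' e') x * T e' x ℓ * (W (tgt' e') (σ e' x))ᵀ) ∧
      (∀ e' x, ‖A e' x‖ ≤ 2 * (Real.sqrt (Fintype.card o) * D)) ∧
      ∀ (wc : ℝ) (_hwc : 0 ≤ wc) (_hw : wc * ℓ * m ≤ wf) (u : ν × o → ℝ) (Φ : (ν × o → ℝ) → μ → ℝ) (ϖ ϖ' : ℝ)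
        (_hP : ∀ y, ∑ x, q y x * (((W y x *ᵥ fun b => u (x, b)) - fun a => (Q *ᵥ u) (y, a)) ⬝ᵥ
          ((W y x *ᵥ fun b => u (x, b)) - fun a => (Q *ᵥ u) (y, a))) ≤ Φ u y)
        (_hΦ : wc * ∑ e', Φ u (tgt' e') ≤ ϖ * (u ⬝ᵥ (Hf *ᵥ u))) (_hΦ' : wc * ∑ e', Φ u (src' e') ≤ ϖ' * (u ⬝ᵥ (Hf *ᵥ u)))
        (s t r : ℝ) (_hs : 0 < s) (_ht : 0 < t) (_hr : 0 < r),
        (∀ Hc : Matrix (μ × o) (μ × o) ℝ,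
          (∀ v : μ × o → ℝ, v ⬝ᵥ (Hc *ᵥ v) ≤
            wc * ∑ e', ((R' e' *ᵥ fun a => v (tgt' e', a)) - fun a => v (src' e', a)) ⬝ᵥ
              ((R' e' *ᵥ fun a => v (tgt' e', a)) - fun a => v (src' e', a))) →
          (Q *ᵥ u) ⬝ᵥ (Hc *ᵥ (Q *ᵥ u)) ≤
            (1 + t + (1 + t⁻¹) * (1 + r) * ϖ * (2 * D) ^ 2 +
                (1 + t⁻¹) * (1 + r⁻¹) * (3 * (2 * D) ^ 2 / (4 - (2 * D) ^ 2)) * (1 + ϖ + ϖ')) * (u ⬝ᵥ (Hf *ᵥ u))) ∧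
        (∀ Hc'' : Matrix (μ × o) (μ × o) ℝ,
          (∀ v : μ × o → ℝ, v ⬝ᵥ (Hc'' *ᵥ v) ≤
            wc * ∑ e', (((exp (∑ x : {x : ν // q (src' e') x ≠ 0}, q (src' e') x • A e' x) *
                (W (src' e') (x₀ e') * T e' (x₀ e') ℓ * (W (tgt' e') (σ e' (x₀ e')))ᵀ)) *ᵥ fun a => v (tgt' e', a)) - fun a => v (src' e', a)) ⬝ᵥ
              (((exp (∑ x : {x : ν // q (src' e') x ≠ 0}, q (src' e') x • A e' x) *
                (W (src' e') (x₀ e') * T e' (x₀ e') ℓ * (W (tgt' e') (σ e' (x₀ e')))ᵀ)) *ᵥ fun a => v (tgt' e', a)) - fun a => v (src' e', a))) →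
          (Q *ᵥ u) ⬝ᵥ (Hc'' *ᵥ (Q *ᵥ u)) ≤
            (1 + s) * ((1 + t + (1 + t⁻¹) * (1 + r) * ϖ * (2 * D) ^ 2 +
                (1 + t⁻¹) * (1 + r⁻¹) * (3 * (2 * D) ^ 2 / (4 - (2 * D) ^ 2)) * (1 + ϖ + ϖ')) * (u ⬝ᵥ (Hf *ᵥ u))) +
              (1 + s⁻¹) * (20 * (Real.sqrt (Fintype.card o) * D) ^ 3 + 784 * (Real.sqrt (Fintype.card o) * D) ^ 4) ^ 2 * wc * d' *
                ((Q *ᵥ u) ⬝ᵥ (Q *ᵥ u))) := by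
  -- (a) the polar links
  obtain ⟨R', hR'o, hsym, hPpsd⟩ := exists_polarLink (W := W) (T := T) (σ := σ) (src' := src') (tgt' := tgt') (ℓ := ℓ) hq hq1 hloop hD0 hD1
  -- the open transports are orthogonal
  have hτo : ∀ e' x, (W (src' e') x * T e' x ℓ * (W (tgt' e') (σ e' x))ᵀ)ᵀ * (W (src' e') x * T e' x ℓ * (W (tgt' e') (σ e' x))ᵀ) = 1 :=
    fun e' x => orthogonal_mul (orthogonal_mul (hW _ _)
      (orthogonal_partialTransport (R := fun i => R (γ e' x i)) (fun i _ => hR _) (hT0 e' x) (fun i hi => hT e' x i hi) ℓ le_rfl))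
      (transpose_orthogonal (hW _ _))
  -- (b) the logarithms and the transfer letter
  obtain ⟨A, hAt, hAe, hA2, hletter⟩ := transferLetter_of_transports_local (o := o)
    (τ := fun e' x => W (src' e') x * T e' x ℓ * (W (tgt' e') (σ e' x))ᵀ) hq hq1 hτo hD0 hloop hD8 hx₀
  have hτ' := hletter R' hR'o hsym hPpsd
  refine ⟨R', A, hR'o, hAt, hAe, hA2, ?_⟩
  intro wc hwc hw u Φ ϖ ϖ' hP hΦ hΦ' s t r hs ht hr
  refine ⟨fun Hc hHc => ?_, fun Hc'' hHc'' => ?_⟩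
  · exact covJensen_polar_massFree_of_loops_local (N := fun e' x => 1 - W (src' e') x * T e' x ℓ * (W (tgt' e') (σ e' x))ᵀ * (R' e')ᵀ)
      hq hq1 hW hR hR'o hQ hwc hHc hHf hσq hx0 hxℓ hsrc htgt hT0 hT hmult hw (fun _ _ => rfl) hsym hPpsd hloop hD1 hD0 u hP hΦ hΦ' ht hr
  · exact covJensen_transfer_of_polar_local
      (R'' := fun e' => exp (∑ x : {x : ν // q (src' e') x ≠ 0}, q (src' e') x • A e' x) *
        (W (src' e') (x₀ e') * T e' (x₀ e') ℓ * (W (tgt' e') (σ e' (x₀ e')))ᵀ))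
      hq hq1 hW hR hR'o hQ hwc hHc'' hτ' hHf hσq hx0 hxℓ hsrc htgt hT0 hT hmult hw hsym hPpsd hloop hD0 hD1 hdeg u hP hΦ hΦ' hs ht hr

end End

end Summit.QuantumFields.BalabanUV.Beta.GAN24.DerivativeRateTransferJensenMassFreeExpMeanEnd
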